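import Literature.NumberTheory.LFunctions.LagariasDifferencedXiSpacingDistributionProofs
import Literature.NumberTheory.LFunctions.SelbergExplicitFormula
import Literature.NumberTheory.LFunctions.ZetaLogDerivRePartialFraction
import Mathlib.NumberTheory.AbelSummation
import Mathlib.NumberTheory.Chebyshev
import HarnessLib

/-!
# `ζ′/ζ(σ + it) ≪ (log t)^{2−2σ}` for `½ < σ < 1` under RH (Titchmarsh Thm 14.5, (14.5.1)); Lagarias 2005, Lemma 4.1 (3) and Theorem 4.1 (2)

LINE 1 — LABEL: RH-CONSEQUENCE literature: the Riemann hypothesis is the explicit hypothesis of every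
statement in this file and is never asserted. bears_on: LADDER-RH B-C/B-P (COLUMN 6, de Branges; cell
rh-crit/dbl, corpus C2, node La05:L4.1(3)/T4.1(2)). WHAT THIS IS NOT: a bound for `ζ′/ζ` ASSUMING RH and
its printed corollary about the normalised zero spacings of the AUXILIARY functions `A_{h,θ}`, `B_{h,θ}` of
Lagarias — not evidence for RH, not a route; nothing here bears on the truth of RH.

Everything here is PROVED (theorems only; no definitions, no named facts).

## Main statements (namespace `Literature.NumberTheory.LFunctions`)

* `LittlewoodRH.norm_logDeriv_zeta_le_log_rpow` — **Titchmarsh, Theorem 14.5, (14.5.1)** (Littlewood):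
  under RH, for every fixed `½ < σ < 1` there is `C` with `‖ζ′/ζ(σ + it)‖ ≤ C (log t)^{2−2σ}` for all
  `t ≥ 3`.
* `lagarias2005_lemma_4_1_3_holds : lagarias2005_lemma_4_1_3` — DISCHARGE of Lagarias 2005, Lemma 4.1 (3)
  ("shown in Titchmarsh", Thm 14.5): under RH, for `0 < h < ½`, `R_h(T) = sup_{T ≤ t ≤ T+1} |ζ′/ζ(½+h+it)|
  = O((log T)^{1−2h})`.
* `lagarias2005_thm_4_1_2_holds : lagarias2005_thm_4_1_2` — DISCHARGE of Lagarias 2005, Theorem 4.1 (2),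
  by `lagarias2005_thm_4_1_2_of_lemma_4_1_3` (`LagariasDifferencedXiSpacingDistributionProofs.lean`).

## The proof, and the deviation of record

Titchmarsh's printed proof of (14.5.1) (§14.5, from the Mellin-kernel formula (14.4.2) of §14.4) is NOT
followed. Instead the file follows Montgomery–Vaughan, *Multiplicative Number Theory I*, Theorem 13.13 /
Corollary 13.14 (held copy pp. 332–333; "all results from Theorem 13.13 through 13.21 are due to
Littlewood"): an explicit formula with a TWO-SCALE weight — plateau up to `x`, decay over a window of
fixed multiplicative length `y = e^{1/(σ−½)}` — in which, under RH, the sum over the zeros is at most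
`2x^{½−σ}/((σ−½) log y) · Σ_ρ Re 1/(s−ρ)`, and `Σ_ρ Re 1/(s−ρ) = Re ξ′/ξ(s) = Re ζ′/ζ(s) + ½ log t + O(1)`;
with `x ≍ (log t)²` the coefficient of `|ζ′/ζ|` on the right is `< 1` and everything else is
`O((log t)^{2−2σ})`. The tree's exact smoothed explicit formula of Ford
(`SmoothedEF.fordK_eq_explicit`, `SmoothedExplicitFormulaContour.lean`) is used with the `C¹` two-scale
smoothing `f = (g_a − 2g_{a+b} + g_{a+2b})/(2b²)`, `g_c(u) = (c − u)₊²`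
(`SelbergExplicit.quadPiece`; `a = log x`, `b = log y`), i.e. Selberg's smoothing
(`SelbergExplicit.smoothing b`) translated so that its plateau has length `a`: its transform is
`−e^{−az}(1 − e^{−bz})²/(b²z³)` (`LittlewoodRH.comb_fordLaplace₀_eq`), bounded at `z = s − ρ`, `Re z = σ − ½ =: d`,
by `4e^{−ad}/(b²d²) · Re(1/z)`; the Dirichlet-polynomial side is `≤ Σ_{n ≤ xy²} Λ(n) n^{−σ} ≪ (xy²)^{1−σ}/(1−σ)`
by partial summation against Chebyshev's `ψ(u) ≤ (log 4 + 4)u` (Mathlib); the left-line remainder is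
handled exactly as in `SelbergExplicit.norm_remainder_le`. Choice: `b = 1/d`, `a = (log 8)/d + 2 log log t`
(so `x = 8^{1/d}(log t)²` and the coefficient is `½(log t)^{−2d} ≤ ½`).

## References

* [Titchmarsh1986] E. C. Titchmarsh, *The Theory of the Riemann Zeta-Function*, 2nd ed. (rev.
  D. R. Heath-Brown), OUP 1986, Theorem 14.5, (14.5.1) (held copy p. 251).
* [MontgomeryVaughan2007] H. L. Montgomery, R. C. Vaughan, *Multiplicative Number Theory I*, CUP 2007,
  §13.2, (13.35), Theorem 13.13, Corollary 13.14 (held copy pp. 332–333).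
* [Lagarias2005] J. C. Lagarias, *Zero spacing distributions for differenced L-functions*, Acta Arith.
  120 (2005) = arXiv:math/0601653, Lemma 4.1 (3), Theorem 4.1 (2) (arXiv p. 8).
-/

noncomputable section

open Complex MeasureTheory Set Filter Topology
open scoped Real

namespace Literature.NumberTheory.LFunctions

namespace LittlewoodRH

open SelbergExplicit

/-! ## A. The Dirichlet-polynomial side: `Σ_{n ≤ N} Λ(n) n^{−σ} ≪ N^{1−σ}/(1−σ)` (Chebyshev) -/

/-- `Σ_{k ≤ n} Λ(k) = ψ(n)` for natural `n`. [folklore] -/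
private theorem sum_Icc_vonMangoldt_eq_psi (n : ℕ) :
    ∑ k ∈ Finset.Icc 0 n, (ArithmeticFunction.vonMangoldt k : ℝ) = Chebyshev.psi n := by
  rw [Chebyshev.psi_eq_sum_Icc, Nat.floor_natCast]

/-- **Chebyshev by partial summation**: `Σ_{1 < n ≤ N} Λ(n) n^{−σ} ≤ (log 4 + 4) N^{1−σ}/(1 − σ)` for
`0 < σ < 1` (`= ψ(N)N^{−σ} + σ∫₁^N ψ(u)u^{−σ−1} du`, `ψ(u) ≤ (log 4 + 4)u`). [folklore] -/
private theorem sum_Ioc_vonMangoldt_mul_rpow_le {σ : ℝ} (hσ0 : 0 < σ) (hσ1 : σ < 1) {N : ℕ}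
    (hN : 1 ≤ N) :
    ∑ n ∈ Finset.Ioc 1 N, (ArithmeticFunction.vonMangoldt n : ℝ) * (n : ℝ) ^ (-σ) ≤
      (Real.log 4 + 4) * (N : ℝ) ^ (1 - σ) / (1 - σ) := by
  set c : ℝ := Real.log 4 + 4 with hc
  have hlog4 : 0 < Real.log 4 := Real.log_pos (by norm_num)
  have hc0 : 0 < c := by rw [hc]; linarith
  have hNr : (1 : ℝ) ≤ N := by exact_mod_cast hN
  have hNpos : (0 : ℝ) < N := by linarith
  have h1σ : 0 < 1 - σ := by linarith
  set g : ℝ → ℝ := fun u ↦ u ^ (-σ) with hg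
  have hsum : ∑ n ∈ Finset.Ioc 1 N, (ArithmeticFunction.vonMangoldt n : ℝ) * (n : ℝ) ^ (-σ) =
      ∑ k ∈ Finset.Ioc 1 N, g k * (ArithmeticFunction.vonMangoldt k : ℝ) := by
    refine Finset.sum_congr rfl fun k _ ↦ ?_
    simp only [hg]; ring
  rw [hsum]
  have hgd : ∀ u : ℝ, 0 < u → HasDerivAt g (-σ * u ^ (-σ - 1)) u := fun u hu ↦ by
    simpa using Real.hasDerivAt_rpow_const (p := -σ) (Or.inl hu.ne')
  have hg_diff : ∀ u ∈ Set.Icc ((1 : ℕ) : ℝ) N, DifferentiableAt ℝ g u := fun u hu ↦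
    (hgd u (by simp only [Nat.cast_one] at hu; linarith [hu.1])).differentiableAt
  have hg_deriv : ∀ u : ℝ, 0 < u → deriv g u = -σ * u ^ (-σ - 1) := fun u hu ↦ (hgd u hu).deriv
  have hcont : ContinuousOn (fun u : ℝ ↦ -σ * u ^ (-σ - 1)) (Set.Icc ((1 : ℕ) : ℝ) N) :=
    continuousOn_const.mul (continuousOn_id.rpow_const fun u hu ↦ Or.inl (by
      simp only [id, Nat.cast_one] at hu ⊢; linarith [hu.1]))
  have hg_int : IntegrableOn (deriv g) (Set.Icc ((1 : ℕ) : ℝ) N) := by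
    refine (hcont.integrableOn_Icc).congr_fun (fun u hu ↦ ?_) measurableSet_Icc
    exact (hg_deriv u (by simp only [Nat.cast_one] at hu; linarith [hu.1])).symm
  have habel := sum_mul_eq_sub_sub_integral_mul' (fun k ↦ (ArithmeticFunction.vonMangoldt k : ℝ))
    hN hg_diff hg_int
  simp_rw [sum_Icc_vonMangoldt_eq_psi] at habel
  rw [habel]
  -- the boundary terms
  have hψN : Chebyshev.psi (N : ℝ) ≤ c * N := Chebyshev.psi_le_const_mul_self hNpos.le
  have hψ1 : Chebyshev.psi ((1 : ℕ) : ℝ) = 0 := by rw [Nat.cast_one]; exact Chebyshev.psi_one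
  have hT1 : g N * Chebyshev.psi (N : ℝ) ≤ c * (N : ℝ) ^ (1 - σ) := by
    have hgN : 0 ≤ g N := Real.rpow_nonneg hNpos.le _
    calc g N * Chebyshev.psi (N : ℝ) ≤ g N * (c * N) := mul_le_mul_of_nonneg_left hψN hgN
      _ = c * (N : ℝ) ^ (1 - σ) := by
          rw [hg, show (1 : ℝ) - σ = -σ + 1 by ring, Real.rpow_add_one hNpos.ne']; ring
  -- the integral
  have hT3 : ‖∫ t in Set.Ioc ((1 : ℕ) : ℝ) N, deriv g t * Chebyshev.psi (⌊t⌋₊ : ℕ)‖ ≤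
      σ * c * (N : ℝ) ^ (1 - σ) / (1 - σ) := by
    set bound : ℝ → ℝ := fun t ↦ σ * c * t ^ (-σ) with hbound
    have hbcont : ContinuousOn bound (Set.Icc ((1 : ℕ) : ℝ) N) :=
      continuousOn_const.mul (continuousOn_id.rpow_const fun u hu ↦ Or.inl (by
        simp only [id, Nat.cast_one] at hu ⊢; linarith [hu.1]))
    have hbint : IntegrableOn bound (Set.Ioc ((1 : ℕ) : ℝ) N) :=
      (hbcont.integrableOn_Icc).mono_set Set.Ioc_subset_Icc_self
    have hle : ∀ᵐ t ∂(volume.restrict (Set.Ioc ((1 : ℕ) : ℝ) N)),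
        ‖deriv g t * Chebyshev.psi (⌊t⌋₊ : ℕ)‖ ≤ bound t := by
      rw [ae_restrict_iff' measurableSet_Ioc]
      refine Filter.Eventually.of_forall fun t ht ↦ ?_
      have ht0 : 0 < t := by simp only [Nat.cast_one] at ht; linarith [ht.1]
      have hfl : Chebyshev.psi ((⌊t⌋₊ : ℕ) : ℝ) ≤ c * t :=
        (Chebyshev.psi_le_const_mul_self (Nat.cast_nonneg _)).trans
          (mul_le_mul_of_nonneg_left (Nat.floor_le ht0.le) hc0.le)
      have hpow_pos := Real.rpow_pos_of_pos ht0 (-σ - 1)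
      rw [hg_deriv t ht0, norm_mul, Real.norm_eq_abs, Real.norm_eq_abs,
        abs_of_nonneg (Chebyshev.psi_nonneg _), abs_of_nonpos (by nlinarith), hbound]
      have hpow : t ^ (-σ - 1) * t = t ^ (-σ) := by
        rw [← Real.rpow_add_one ht0.ne']
        congr 1
        ring
      calc -(-σ * t ^ (-σ - 1)) * Chebyshev.psi ((⌊t⌋₊ : ℕ) : ℝ)
          ≤ -(-σ * t ^ (-σ - 1)) * (c * t) := mul_le_mul_of_nonneg_left hfl (by nlinarith)
        _ = σ * c * (t ^ (-σ - 1) * t) := by ring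
        _ = σ * c * t ^ (-σ) := by rw [hpow]
    have hI := norm_integral_le_of_norm_le hbint hle
    have h1N : ((1 : ℕ) : ℝ) ≤ N := by simpa using hNr
    have hprim : ∀ t ∈ Set.uIcc ((1 : ℕ) : ℝ) N,
        HasDerivAt (fun t : ℝ ↦ σ * c * (t ^ (1 - σ) / (1 - σ))) (bound t) t := by
      intro t ht
      rw [Set.uIcc_of_le h1N] at ht
      have ht0 : 0 < t := by simp only [Nat.cast_one] at ht; linarith [ht.1]
      have h1 := Real.hasDerivAt_rpow_const (p := 1 - σ) (Or.inl ht0.ne')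
      have h2 := (h1.div_const (1 - σ)).const_mul (σ * c)
      refine h2.congr_deriv ?_
      rw [hbound]
      simp only
      rw [show (1 : ℝ) - σ - 1 = -σ by ring]
      field_simp [h1σ.ne']
    have hval : ∫ t in Set.Ioc ((1 : ℕ) : ℝ) N, bound t =
        σ * c * ((N : ℝ) ^ (1 - σ) / (1 - σ)) - σ * c * (((1 : ℕ) : ℝ) ^ (1 - σ) / (1 - σ)) := by
      rw [← intervalIntegral.integral_of_le h1N,
        intervalIntegral.integral_eq_sub_of_hasDerivAt hprim
          ((hbcont.mono (by rw [Set.uIcc_of_le h1N])).intervalIntegrable)]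
    have h1pow : ((1 : ℕ) : ℝ) ^ (1 - σ) = 1 := by rw [Nat.cast_one, Real.one_rpow]
    rw [hval, h1pow] at hI
    have hsub : 0 ≤ σ * c * (1 / (1 - σ)) := by positivity
    calc ‖∫ t in Set.Ioc ((1 : ℕ) : ℝ) N, deriv g t * Chebyshev.psi (⌊t⌋₊ : ℕ)‖
        ≤ σ * c * ((N : ℝ) ^ (1 - σ) / (1 - σ)) - σ * c * (1 / (1 - σ)) := hI
      _ ≤ σ * c * ((N : ℝ) ^ (1 - σ) / (1 - σ)) := by linarith
      _ = σ * c * (N : ℝ) ^ (1 - σ) / (1 - σ) := by ring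
  -- assemble
  have hNpow : 0 ≤ (N : ℝ) ^ (1 - σ) := Real.rpow_nonneg hNpos.le _
  have hfin : g N * Chebyshev.psi (N : ℝ) - g ((1 : ℕ) : ℝ) * Chebyshev.psi ((1 : ℕ) : ℝ) -
      ∫ t in Set.Ioc ((1 : ℕ) : ℝ) N, deriv g t * Chebyshev.psi (⌊t⌋₊ : ℕ) ≤
      c * (N : ℝ) ^ (1 - σ) + σ * c * (N : ℝ) ^ (1 - σ) / (1 - σ) := by
    have := neg_le_abs (∫ t in Set.Ioc ((1 : ℕ) : ℝ) N, deriv g t * Chebyshev.psi (⌊t⌋₊ : ℕ))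
    rw [← Real.norm_eq_abs] at this
    rw [hψ1, mul_zero, sub_zero, sub_eq_add_neg]
    exact add_le_add hT1 (this.trans hT3)
  refine hfin.trans (le_of_eq ?_)
  field_simp
  ring

/-- `Σ_{n < N} Λ(n) n^{−σ} ≤ (log 4 + 4) N^{1−σ}/(1 − σ)` for `0 < σ < 1` (the terms `n = 0, 1` vanish).
[folklore] -/
private theorem sum_range_vonMangoldt_mul_rpow_le {σ : ℝ} (hσ0 : 0 < σ) (hσ1 : σ < 1) (N : ℕ) :
    ∑ n ∈ Finset.range N, (ArithmeticFunction.vonMangoldt n : ℝ) * (n : ℝ) ^ (-σ) ≤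
      (Real.log 4 + 4) * (N : ℝ) ^ (1 - σ) / (1 - σ) := by
  rcases Nat.eq_zero_or_pos N with rfl | hN
  · simp [Real.zero_rpow (show (1 : ℝ) - σ ≠ 0 by linarith)]
  have hsub : ∑ n ∈ Finset.range N, (ArithmeticFunction.vonMangoldt n : ℝ) * (n : ℝ) ^ (-σ) =
      ∑ n ∈ (Finset.range N).filter (fun n ↦ 1 < n),
        (ArithmeticFunction.vonMangoldt n : ℝ) * (n : ℝ) ^ (-σ) := by
    rw [Finset.sum_filter_of_ne]
    intro n _ hne
    by_contra hn
    push Not at hn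
    interval_cases n
    · simp at hne
    · simp [ArithmeticFunction.vonMangoldt_apply_one] at hne
  rw [hsub]
  calc ∑ n ∈ (Finset.range N).filter (fun n ↦ 1 < n),
        (ArithmeticFunction.vonMangoldt n : ℝ) * (n : ℝ) ^ (-σ)
      ≤ ∑ n ∈ Finset.Ioc 1 N, (ArithmeticFunction.vonMangoldt n : ℝ) * (n : ℝ) ^ (-σ) := by
        refine Finset.sum_le_sum_of_subset_of_nonneg (fun n hn ↦ ?_) fun n _ _ ↦
          mul_nonneg ArithmeticFunction.vonMangoldt_nonneg (Real.rpow_nonneg (Nat.cast_nonneg _) _)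
        simp only [Finset.mem_filter, Finset.mem_range] at hn
        simp only [Finset.mem_Ioc]
        omega
    _ ≤ _ := sum_Ioc_vonMangoldt_mul_rpow_le hσ0 hσ1 hN

/-! ## B. The two-scale kernel -/

/-- **The two-scale kernel**: `F₀^{(a)} − 2F₀^{(a+b)} + F₀^{(a+2b)} = −2e^{−az}(1 − e^{−bz})²/z³` (`z ≠ 0`,
`a, b ≥ 0`) — the polynomial parts `−2c/z² + 2/z³` of the transforms of `g_c`, `c = a, a+b, a+2b`, cancel
(Montgomery–Vaughan's weight `w(u)`: `1` up to `x = e^a`, decaying to `0` at `xy²`, `y = e^b`).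
[cite: MontgomeryVaughan2007, §13.2, (13.35) (two-scale weight)] -/
theorem comb_fordLaplace₀_eq {a b : ℝ} (ha : 0 ≤ a) (hb : 0 ≤ b) {z : ℂ} (hz : z ≠ 0) :
    fordLaplace₀ (quadPiece a) z - 2 * fordLaplace₀ (quadPiece (a + b)) z +
        fordLaplace₀ (quadPiece (a + 2 * b)) z =
      -2 * Complex.exp (-(z * a)) * (1 - Complex.exp (-(z * b))) ^ 2 / z ^ 3 := by
  rw [fordLaplace₀_quadPiece ha hz, fordLaplace₀_quadPiece (by linarith) hz,
    fordLaplace₀_quadPiece (by linarith) hz]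
  have h2 : Complex.exp (-(z * ((a + b : ℝ) : ℂ))) =
      Complex.exp (-(z * a)) * Complex.exp (-(z * b)) := by
    rw [← Complex.exp_add]; congr 1; push_cast; ring
  have h3 : Complex.exp (-(z * ((a + 2 * b : ℝ) : ℂ))) =
      Complex.exp (-(z * a)) * Complex.exp (-(z * b)) ^ 2 := by
    rw [sq, ← Complex.exp_add, ← Complex.exp_add]; congr 1; push_cast; ring
  rw [h2, h3]
  push_cast
  field_simp
  ring

/-- A crude bound for the kernel: `‖−2e^{−az}(1−e^{−bz})²/z³‖ ≤ 2e^{−a Re z}(1 + e^{−b Re z})²/‖z‖³`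
(`z ≠ 0`). [folklore] -/
private theorem norm_kernel_le {a b : ℝ} {z : ℂ} (hz : z ≠ 0) :
    ‖-2 * Complex.exp (-(z * a)) * (1 - Complex.exp (-(z * b))) ^ 2 / z ^ 3‖ ≤
      2 * Real.exp (-(a * z.re)) * (1 + Real.exp (-(b * z.re))) ^ 2 / ‖z‖ ^ 3 := by
  have hexp : ‖Complex.exp (-(z * a))‖ = Real.exp (-(a * z.re)) := by
    rw [Complex.norm_exp]; congr 1; simp [Complex.mul_re]; ring
  have hexpb : ‖Complex.exp (-(z * b))‖ = Real.exp (-(b * z.re)) := by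
    rw [Complex.norm_exp]; congr 1; simp [Complex.mul_re]; ring
  have h1 : ‖(1 : ℂ) - Complex.exp (-(z * b))‖ ≤ 1 + Real.exp (-(b * z.re)) := by
    refine (norm_sub_le _ _).trans ?_
    rw [norm_one, hexpb]
  have hz3 : 0 < ‖z‖ ^ 3 := pow_pos (norm_pos_iff.2 hz) 3
  rw [norm_div, norm_mul, norm_mul, norm_neg, norm_pow, norm_pow, Complex.norm_ofNat, hexp]
  refine div_le_div_of_nonneg_right ?_ hz3.le
  have h0 : 0 ≤ ‖(1 : ℂ) - Complex.exp (-(z * b))‖ := norm_nonneg _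
  have := mul_le_mul h1 h1 h0 (by positivity)
  have he0 : 0 ≤ 2 * Real.exp (-(a * z.re)) := by positivity
  nlinarith

/-- On the left line (`Re z ≥ 1`): `‖kernel‖ ≤ 8e^{−a Re z}/(1/4 + (Im z)²)` (`a, b ≥ 0`), as in
`SelbergExplicit.norm_combF₀_le`. [folklore] -/
private theorem norm_kernel_le_left {a b : ℝ} (hb : 0 ≤ b) {z : ℂ} (hz : 1 ≤ z.re) :
    ‖-2 * Complex.exp (-(z * a)) * (1 - Complex.exp (-(z * b))) ^ 2 / z ^ 3‖ ≤
      8 * Real.exp (-(a * z.re)) / (1 / 4 + z.im ^ 2) := by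
  have hz0 : z ≠ 0 := fun h ↦ by rw [h, Complex.zero_re] at hz; linarith
  refine (norm_kernel_le hz0).trans ?_
  have heb : Real.exp (-(b * z.re)) ≤ 1 := by
    rw [Real.exp_le_one_iff]; nlinarith
  have hnz : 1 / 4 + z.im ^ 2 ≤ ‖z‖ ^ 2 := by
    rw [Complex.sq_norm, Complex.normSq_apply]; nlinarith
  have hnz1 : 1 ≤ ‖z‖ := hz.trans (Complex.re_le_norm z)
  have hpos : 0 < 1 / 4 + z.im ^ 2 := by positivity
  have hz3 : 1 / 4 + z.im ^ 2 ≤ ‖z‖ ^ 3 := by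
    calc 1 / 4 + z.im ^ 2 ≤ ‖z‖ ^ 2 := hnz
      _ = ‖z‖ ^ 2 * 1 := (mul_one _).symm
      _ ≤ ‖z‖ ^ 2 * ‖z‖ := by gcongr
      _ = ‖z‖ ^ 3 := by ring
  have he0 : 0 ≤ Real.exp (-(a * z.re)) := (Real.exp_pos _).le
  have hsq : (1 + Real.exp (-(b * z.re))) ^ 2 ≤ 4 := by nlinarith [Real.exp_pos (-(b * z.re))]
  rw [div_le_div_iff₀ (by positivity) hpos]
  calc 2 * Real.exp (-(a * z.re)) * (1 + Real.exp (-(b * z.re))) ^ 2 * (1 / 4 + z.im ^ 2)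
      ≤ 2 * Real.exp (-(a * z.re)) * 4 * ‖z‖ ^ 3 := by
        have := mul_le_mul hsq hz3 hpos.le (by norm_num : (0 : ℝ) ≤ 4)
        nlinarith
    _ = 8 * Real.exp (-(a * z.re)) * ‖z‖ ^ 3 := by ring

/-- On the zero side (`Re z = d > 0`): `‖kernel‖ ≤ (8e^{−ad}/d²) · Re(1/z)`, since `‖z‖ ≥ d` and
`Re(1/z) = d/‖z‖²` — the step "`|y^{ρ−s} − 1| ≤ 2`, hence the sum over `ρ` is at most
`2x^{1/2−σ}/log y · Σ 1/|s−ρ|²`" of the printed proof. [cite: MontgomeryVaughan2007, Thm 13.13 (proof)] -/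
private theorem norm_kernel_le_zero {a b : ℝ} (hb : 0 ≤ b) {z : ℂ} (hz : 0 < z.re) :
    ‖-2 * Complex.exp (-(z * a)) * (1 - Complex.exp (-(z * b))) ^ 2 / z ^ 3‖ ≤
      8 * Real.exp (-(a * z.re)) / z.re ^ 2 * (1 / z).re := by
  have hz0 : z ≠ 0 := fun h ↦ by rw [h, Complex.zero_re] at hz; exact lt_irrefl _ hz
  refine (norm_kernel_le hz0).trans ?_
  have heb : Real.exp (-(b * z.re)) ≤ 1 := by
    rw [Real.exp_le_one_iff]; nlinarith
  have hsq : (1 + Real.exp (-(b * z.re))) ^ 2 ≤ 4 := by nlinarith [Real.exp_pos (-(b * z.re))]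
  have hnorm : z.re ≤ ‖z‖ := Complex.re_le_norm z
  have hn0 : 0 < ‖z‖ := hz.trans_le hnorm
  have hre : (1 / z).re = z.re / ‖z‖ ^ 2 := by
    rw [one_div, Complex.inv_re, Complex.normSq_eq_norm_sq]
  rw [hre]
  have he0 : 0 ≤ Real.exp (-(a * z.re)) := (Real.exp_pos _).le
  -- `2E·(1+e)²/‖z‖³ ≤ 8E/‖z‖³ ≤ 8E/(z.re ‖z‖²) = (8E/z.re²)(z.re/‖z‖²)`
  calc 2 * Real.exp (-(a * z.re)) * (1 + Real.exp (-(b * z.re))) ^ 2 / ‖z‖ ^ 3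
      ≤ 8 * Real.exp (-(a * z.re)) / ‖z‖ ^ 3 := by
        refine div_le_div_of_nonneg_right ?_ (by positivity)
        nlinarith
    _ ≤ 8 * Real.exp (-(a * z.re)) / (z.re * ‖z‖ ^ 2) := by
        refine div_le_div_of_nonneg_left (by positivity) (by positivity) ?_
        calc z.re * ‖z‖ ^ 2 ≤ ‖z‖ * ‖z‖ ^ 2 := by gcongr
          _ = ‖z‖ ^ 3 := by ring
    _ = 8 * Real.exp (-(a * z.re)) / z.re ^ 2 * (z.re / ‖z‖ ^ 2) := by
        field_simp

/-! ## C. The Dirichlet polynomial of the two-scale smoothing -/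

/-- `g_a − 2g_{a+b} + g_{a+2b} = 2b² f_b(· − a + b)`: the two-scale smoothing is Selberg's `f_b`
translated to have its plateau of length `a`. [folklore] -/
private theorem comb_quadPiece_eq (a b u : ℝ) :
    quadPiece a u - 2 * quadPiece (a + b) u + quadPiece (a + 2 * b) u =
      quadPiece b (u - a + b) - 2 * quadPiece (2 * b) (u - a + b) + quadPiece (3 * b) (u - a + b) := by
  have e1 : quadPiece b (u - a + b) = quadPiece a u := by
    simp only [quadPiece]; rw [show b - (u - a + b) = a - u by ring]
  have e2 : quadPiece (2 * b) (u - a + b) = quadPiece (a + b) u := by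
    simp only [quadPiece]; rw [show 2 * b - (u - a + b) = a + b - u by ring]
  have e3 : quadPiece (3 * b) (u - a + b) = quadPiece (a + 2 * b) u := by
    simp only [quadPiece]; rw [show 3 * b - (u - a + b) = a + 2 * b - u by ring]
  rw [e1, e2, e3]

/-- `|g_a − 2g_{a+b} + g_{a+2b}| ≤ 2b²` (`b > 0`), from `0 ≤ f_b ≤ 1`. [folklore] -/
private theorem abs_comb_quadPiece_le {a b : ℝ} (hb : 0 < b) (u : ℝ) :
    |quadPiece a u - 2 * quadPiece (a + b) u + quadPiece (a + 2 * b) u| ≤ 2 * b ^ 2 := by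
  rw [comb_quadPiece_eq]
  have h0 := smoothing_nonneg hb (u - a + b)
  have h1 := smoothing_le_one hb (u - a + b)
  have hb2 : 0 < 2 * b ^ 2 := by positivity
  have e : quadPiece b (u - a + b) - 2 * quadPiece (2 * b) (u - a + b) + quadPiece (3 * b) (u - a + b) =
      2 * b ^ 2 * smoothing b (u - a + b) := by
    rw [smoothing]; field_simp
  rw [e, abs_le]
  constructor <;> nlinarith

/-- **The Dirichlet-polynomial side**: `‖K_{g_a} − 2K_{g_{a+b}} + K_{g_{a+2b}}‖ ≤ 2b² Σ_{n < N} Λ(n) n^{−Re s}`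
for any `N ≥ 1` with `a + 2b ≤ log N` (`b > 0`). [cite: MontgomeryVaughan2007, Thm 13.13 (proof, the term `Σ w(n)Λ(n)n^{−s}`)] -/
theorem norm_comb_fordK_le {a b : ℝ} (hb : 0 < b) (s : ℂ) {N : ℕ} (hN : 1 ≤ N)
    (hx : a + 2 * b ≤ Real.log N) :
    ‖fordK (quadPiece a) s - 2 * fordK (quadPiece (a + b)) s + fordK (quadPiece (a + 2 * b)) s‖ ≤
      2 * b ^ 2 * ∑ n ∈ Finset.range N, (ArithmeticFunction.vonMangoldt n : ℝ) * (n : ℝ) ^ (-s.re) := by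
  rw [fordK_eq_sum (fun _ hu ↦ quadPiece_of_ge hu) hN (by linarith) s,
    fordK_eq_sum (fun _ hu ↦ quadPiece_of_ge hu) hN (by linarith) s,
    fordK_eq_sum (fun _ hu ↦ quadPiece_of_ge hu) hN hx s,
    Finset.mul_sum, ← Finset.sum_sub_distrib, ← Finset.sum_add_distrib, Finset.mul_sum]
  refine (norm_sum_le _ _).trans (Finset.sum_le_sum fun n _ ↦ ?_)
  have e : ((ArithmeticFunction.vonMangoldt n : ℝ) : ℂ) * (quadPiece a (Real.log n) : ℂ) * (n : ℂ) ^ (-s) -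
      2 * (((ArithmeticFunction.vonMangoldt n : ℝ) : ℂ) * (quadPiece (a + b) (Real.log n) : ℂ) *
        (n : ℂ) ^ (-s)) +
      ((ArithmeticFunction.vonMangoldt n : ℝ) : ℂ) * (quadPiece (a + 2 * b) (Real.log n) : ℂ) *
        (n : ℂ) ^ (-s) =
      ((ArithmeticFunction.vonMangoldt n : ℝ) : ℂ) *
        ((quadPiece a (Real.log n) - 2 * quadPiece (a + b) (Real.log n) +
          quadPiece (a + 2 * b) (Real.log n) : ℝ) : ℂ) * (n : ℂ) ^ (-s) := by
    push_cast; ring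
  rw [e]
  rcases Nat.eq_zero_or_pos n with rfl | hn
  · simp
  have hn' : (0 : ℝ) < n := by exact_mod_cast hn
  have hΛ : 0 ≤ (ArithmeticFunction.vonMangoldt n : ℝ) := ArithmeticFunction.vonMangoldt_nonneg
  rw [norm_mul, norm_mul, Complex.norm_real, Real.norm_eq_abs, abs_of_nonneg hΛ, Complex.norm_real,
    Real.norm_eq_abs, Complex.norm_natCast_cpow_of_pos hn, Complex.neg_re]
  have hw := abs_comb_quadPiece_le (a := a) hb (Real.log n)
  have hp : 0 ≤ (n : ℝ) ^ (-s.re) := Real.rpow_nonneg hn'.le _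
  calc (ArithmeticFunction.vonMangoldt n : ℝ) *
        |quadPiece a (Real.log n) - 2 * quadPiece (a + b) (Real.log n) + quadPiece (a + 2 * b) (Real.log n)| *
        (n : ℝ) ^ (-s.re)
      ≤ (ArithmeticFunction.vonMangoldt n : ℝ) * (2 * b ^ 2) * (n : ℝ) ^ (-s.re) :=
        mul_le_mul_of_nonneg_right (mul_le_mul_of_nonneg_left hw hΛ) hp
    _ = 2 * b ^ 2 * ((ArithmeticFunction.vonMangoldt n : ℝ) * (n : ℝ) ^ (-s.re)) := by ring

/-! ## D. The left-line remainder of the two-scale smoothing -/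

/-- The combined remainder is one absolutely convergent integral on `Re w = −1/2`:
`J_a − 2J_{a+b} + J_{a+2b} = (1/2π) ∫_ℝ (−ζ'/ζ)(−1/2+iy) · kernel(s + 1/2 − iy) dy` (`−1/2 < Re s`,
`a, b ≥ 0`). [folklore] -/
private theorem comb_remainder_eq_integral {a b : ℝ} (ha : 0 ≤ a) (hb : 0 ≤ b) {s : ℂ}
    (hσ₁ : -(1 / 2) < s.re) :
    smoothedEFRemainder (quadPiece a) s - 2 * smoothedEFRemainder (quadPiece (a + b)) s +
        smoothedEFRemainder (quadPiece (a + 2 * b)) s =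
      (1 / (2 * π) : ℂ) *
        ∫ y : ℝ, -(deriv riemannZeta ((((-(1 / 2) : ℝ)) : ℂ) + y * I) /
            riemannZeta ((((-(1 / 2) : ℝ)) : ℂ) + y * I)) *
          (fordLaplace₀ (quadPiece a) (s - ((((-(1 / 2) : ℝ)) : ℂ) + y * I)) -
            2 * fordLaplace₀ (quadPiece (a + b)) (s - ((((-(1 / 2) : ℝ)) : ℂ) + y * I)) +
            fordLaplace₀ (quadPiece (a + 2 * b)) (s - ((((-(1 / 2) : ℝ)) : ℂ) + y * I))) := by
  have hI1 := SmoothedEF.integrable_integrand_left (isSmoothedEFTest_quadPiece ha) hσ₁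
  have hI2 := SmoothedEF.integrable_integrand_left
    (isSmoothedEFTest_quadPiece (a := a + b) (by linarith)) hσ₁
  have hI3 := SmoothedEF.integrable_integrand_left
    (isSmoothedEFTest_quadPiece (a := a + 2 * b) (by linarith)) hσ₁
  have heq : (fun y : ℝ ↦ -(deriv riemannZeta ((((-(1 / 2) : ℝ)) : ℂ) + y * I) /
            riemannZeta ((((-(1 / 2) : ℝ)) : ℂ) + y * I)) *
          (fordLaplace₀ (quadPiece a) (s - ((((-(1 / 2) : ℝ)) : ℂ) + y * I)) -
            2 * fordLaplace₀ (quadPiece (a + b)) (s - ((((-(1 / 2) : ℝ)) : ℂ) + y * I)) +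
            fordLaplace₀ (quadPiece (a + 2 * b)) (s - ((((-(1 / 2) : ℝ)) : ℂ) + y * I)))) = fun y : ℝ ↦
      smoothedEFIntegrand (quadPiece a) s ((((-(1 / 2) : ℝ)) : ℂ) + y * I) -
        2 * smoothedEFIntegrand (quadPiece (a + b)) s ((((-(1 / 2) : ℝ)) : ℂ) + y * I) +
        smoothedEFIntegrand (quadPiece (a + 2 * b)) s ((((-(1 / 2) : ℝ)) : ℂ) + y * I) := by
    funext y
    simp only [smoothedEFIntegrand]
    ring
  have h2 : Integrable fun y : ℝ ↦
      2 * smoothedEFIntegrand (quadPiece (a + b)) s ((((-(1 / 2) : ℝ)) : ℂ) + y * I) := hI2.const_mul 2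
  have h12 : Integrable fun y : ℝ ↦
      smoothedEFIntegrand (quadPiece a) s ((((-(1 / 2) : ℝ)) : ℂ) + y * I) -
        2 * smoothedEFIntegrand (quadPiece (a + b)) s ((((-(1 / 2) : ℝ)) : ℂ) + y * I) := hI1.sub h2
  rw [heq, integral_add h12 hI3, integral_sub hI1 h2, integral_const_mul]
  simp only [smoothedEFRemainder]
  ring

/-- **The left-line remainder is small**: there is an absolute `C > 0` with
`‖J_a − 2J_{a+b} + J_{a+2b}‖ ≤ C (1 + log(1 + |Im s|)) e^{−a(Re s + 1/2)}` for all `a, b ≥ 0`, `Re s ≥ 1/2`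
(the integrand is `O((1 + log(1+|y|)) e^{−a(Re s + 1/2)}/|s + 1/2 − iy|³)`), exactly as in
`SelbergExplicit.norm_remainder_le`. [cite: Titchmarsh1986, Thm. 14.20 (remainder)] -/
theorem norm_comb_remainder_le : ∃ C : ℝ, 0 < C ∧ ∀ a b : ℝ, 0 ≤ a → 0 ≤ b → ∀ s : ℂ, 1 / 2 ≤ s.re →
    ‖smoothedEFRemainder (quadPiece a) s - 2 * smoothedEFRemainder (quadPiece (a + b)) s +
        smoothedEFRemainder (quadPiece (a + 2 * b)) s‖ ≤
      C * (1 + Real.log (1 + |s.im|)) * Real.exp (-(a * (s.re + 1 / 2))) := by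
  obtain ⟨C₀, hC₀, hC⟩ := PsiOneExplicit.exists_norm_logDeriv_riemannZeta_left_le
  have hint1 : Integrable fun u : ℝ ↦ (1 + 2 * Real.log (1 + |u|)) / (1 / 4 + u ^ 2) :=
    PsiOneExplicit.integrable_left_majorant zero_le_one
  have hint0 : Integrable fun u : ℝ ↦ (0 + 2 * Real.log (1 + |u|)) / (1 / 4 + u ^ 2) :=
    PsiOneExplicit.integrable_left_majorant le_rfl
  have hintK : Integrable fun u : ℝ ↦ (1 / 4 + u ^ 2)⁻¹ := by
    refine hint1.mono' (by fun_prop) (ae_of_all _ fun u ↦ ?_)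
    have hl : 0 ≤ Real.log (1 + |u|) := Real.log_nonneg (by linarith [abs_nonneg u])
    rw [Real.norm_eq_abs, abs_of_nonneg (by positivity), inv_eq_one_div]
    exact div_le_div_of_nonneg_right (by linarith) (by positivity)
  set K₁ : ℝ := ∫ u : ℝ, (1 / 4 + u ^ 2)⁻¹ with hK₁
  set K₂ : ℝ := ∫ u : ℝ, (0 + 2 * Real.log (1 + |u|)) / (1 / 4 + u ^ 2) with hK₂
  have hK₁0 : 0 ≤ K₁ := integral_nonneg fun u ↦ by positivity
  have hK₂0 : 0 ≤ K₂ := integral_nonneg fun u ↦ by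
    have hl : 0 ≤ Real.log (1 + |u|) := Real.log_nonneg (by linarith [abs_nonneg u])
    positivity
  refine ⟨4 / π * (C₀ * K₁ + K₂ + 2 * K₁) + 1, by positivity, fun a b ha hb s hσ ↦ ?_⟩
  have hσ₁ : -(1 / 2) < s.re := by linarith
  set t := s.im with ht
  set α := s.re + 1 / 2 with hα
  have hα1 : 1 ≤ α := by rw [hα]; linarith
  set A : ℝ := C₀ + 2 * Real.log (1 + |t|) with hA
  have hlogt : 0 ≤ Real.log (1 + |t|) := Real.log_nonneg (by linarith [abs_nonneg t])
  have hA0 : 0 ≤ A := by positivity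
  -- the majorant and its integral
  set g : ℝ → ℝ := fun y ↦ 8 * Real.exp (-(a * α)) *
    ((A + 2 * Real.log (1 + |y - t|)) / (1 / 4 + (y - t) ^ 2)) with hg
  have hgi : Integrable g :=
    ((PsiOneExplicit.integrable_left_majorant hA0).comp_sub_right t).const_mul _
  have hgint : ∫ y, g y = 8 * Real.exp (-(a * α)) * (A * K₁ + K₂) := by
    rw [hg, integral_const_mul]
    congr 1
    have htr := integral_sub_right_eq_self (μ := volume)
      (fun u : ℝ ↦ (A + 2 * Real.log (1 + |u|)) / (1 / 4 + u ^ 2)) t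
    rw [htr]
    have hsplit : (fun u : ℝ ↦ (A + 2 * Real.log (1 + |u|)) / (1 / 4 + u ^ 2)) = fun u : ℝ ↦
        A * (1 / 4 + u ^ 2)⁻¹ + (0 + 2 * Real.log (1 + |u|)) / (1 / 4 + u ^ 2) := by
      funext u; field_simp; ring
    rw [hsplit, integral_add (hintK.const_mul A) hint0, integral_const_mul]
  -- pointwise bound of the integrand
  have hpt : ∀ y : ℝ, ‖-(deriv riemannZeta ((((-(1 / 2) : ℝ)) : ℂ) + y * I) /
          riemannZeta ((((-(1 / 2) : ℝ)) : ℂ) + y * I)) *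
        (fordLaplace₀ (quadPiece a) (s - ((((-(1 / 2) : ℝ)) : ℂ) + y * I)) -
          2 * fordLaplace₀ (quadPiece (a + b)) (s - ((((-(1 / 2) : ℝ)) : ℂ) + y * I)) +
          fordLaplace₀ (quadPiece (a + 2 * b)) (s - ((((-(1 / 2) : ℝ)) : ℂ) + y * I)))‖ ≤ g y := by
    intro y
    set w : ℂ := (((-(1 / 2) : ℝ)) : ℂ) + y * I with hw
    have hzre : (s - w).re = α := by simp [hw, hα]
    have hzim : (s - w).im = t - y := by simp [hw, ht]
    have hz0 : s - w ≠ 0 := fun h ↦ by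
      have := congrArg Complex.re h
      rw [hzre, Complex.zero_re] at this
      linarith
    have hcomb := norm_kernel_le_left (a := a) hb (z := s - w) (by rw [hzre]; exact hα1)
    rw [← comb_fordLaplace₀_eq ha hb hz0, hzre, hzim] at hcomb
    rw [norm_mul, norm_neg, hg]
    have hζb := hC y
    have hlogy : Real.log (1 + |y|) ≤ Real.log (1 + |t|) + Real.log (1 + |y - t|) :=
      SmoothedEF.log_one_add_abs_le_add y t
    have hlog2 : 0 ≤ Real.log (1 + |y - t|) := Real.log_nonneg (by linarith [abs_nonneg (y - t)])
    have hnum : C₀ + 2 * Real.log (1 + |y|) ≤ A + 2 * Real.log (1 + |y - t|) := by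
      rw [hA]; linarith
    have hden : (t - y) ^ 2 = (y - t) ^ 2 := by ring
    rw [hden] at hcomb
    have hpos : 0 < 1 / 4 + (y - t) ^ 2 := by positivity
    calc ‖deriv riemannZeta w / riemannZeta w‖ *
          ‖fordLaplace₀ (quadPiece a) (s - w) - 2 * fordLaplace₀ (quadPiece (a + b)) (s - w) +
            fordLaplace₀ (quadPiece (a + 2 * b)) (s - w)‖
        ≤ (A + 2 * Real.log (1 + |y - t|)) * (8 * Real.exp (-(a * α)) / (1 / 4 + (y - t) ^ 2)) :=
          mul_le_mul (hζb.trans hnum) hcomb (norm_nonneg _) (by positivity)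
      _ = 8 * Real.exp (-(a * α)) * ((A + 2 * Real.log (1 + |y - t|)) / (1 / 4 + (y - t) ^ 2)) := by
          ring
  -- assemble
  rw [comb_remainder_eq_integral ha hb hσ₁, norm_mul]
  have hn1 : ‖(1 / (2 * π) : ℂ)‖ = 1 / (2 * π) := by
    rw [show (1 / (2 * π) : ℂ) = ((1 / (2 * π) : ℝ) : ℂ) by push_cast; ring, Complex.norm_real,
      Real.norm_eq_abs, abs_of_pos (by positivity)]
  rw [hn1]
  have hI := (norm_integral_le_of_norm_le hgi (ae_of_all _ hpt)).trans_eq hgint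
  calc 1 / (2 * π) * ‖∫ y : ℝ, -(deriv riemannZeta ((((-(1 / 2) : ℝ)) : ℂ) + y * I) /
            riemannZeta ((((-(1 / 2) : ℝ)) : ℂ) + y * I)) *
          (fordLaplace₀ (quadPiece a) (s - ((((-(1 / 2) : ℝ)) : ℂ) + y * I)) -
            2 * fordLaplace₀ (quadPiece (a + b)) (s - ((((-(1 / 2) : ℝ)) : ℂ) + y * I)) +
            fordLaplace₀ (quadPiece (a + 2 * b)) (s - ((((-(1 / 2) : ℝ)) : ℂ) + y * I)))‖
      ≤ 1 / (2 * π) * (8 * Real.exp (-(a * α)) * (A * K₁ + K₂)) :=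
        mul_le_mul_of_nonneg_left hI (by positivity)
    _ = 4 / π * ((C₀ + 2 * Real.log (1 + |t|)) * K₁ + K₂) * Real.exp (-(a * α)) := by
        rw [hA]; field_simp; ring
    _ ≤ 4 / π * ((C₀ * K₁ + K₂ + 2 * K₁) * (1 + Real.log (1 + |t|))) * Real.exp (-(a * α)) := by
        gcongr
        nlinarith [mul_nonneg hC₀.le hK₁0, mul_nonneg hK₁0 hlogt]
    _ ≤ (4 / π * (C₀ * K₁ + K₂ + 2 * K₁) + 1) * (1 + Real.log (1 + |t|)) * Real.exp (-(a * α)) := by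
        have hL : 0 ≤ 1 + Real.log (1 + |t|) := by linarith
        have hE := (Real.exp_pos (-(a * α))).le
        nlinarith [mul_nonneg hL hE]


/-! ## E. The two-scale explicit formula -/

/-- **The two-scale explicit formula**: for `a, b ≥ 0`, `−1/2 < Re s < 3/2`, `s ≠ 1`, `ζ(s) ≠ 0`,
`2b² ζ′/ζ(s) = −(K_a − 2K_{a+b} + K_{a+2b})(s) + kernel(s − 1) − Σ_ρ m(ρ) kernel(s − ρ) + (J_a − 2J_{a+b} + J_{a+2b})(s)`:
three instances of Ford's exact formula `K_g(s) = −g(0)ζ′/ζ(s) + F₀(s−1) − Σ_ρ m(ρ)F₀(s−ρ) + J_g(s)`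
(`SmoothedEF.fordK_eq_explicit`) for `g = g_a, g_{a+b}, g_{a+2b}`, and `a² − 2(a+b)² + (a+2b)² = 2b²`.
[cite: MontgomeryVaughan2007, §13.2, (13.35)] -/
theorem explicit_formula_twoScale {a b : ℝ} (ha : 0 ≤ a) (hb : 0 ≤ b) {s : ℂ} (hσ₁ : -(1 / 2) < s.re)
    (hσ₂ : s.re < 3 / 2) (hs1 : s ≠ 1) (hζs : riemannZeta s ≠ 0) :
    2 * (b : ℂ) ^ 2 * (deriv riemannZeta s / riemannZeta s) =
      -(fordK (quadPiece a) s - 2 * fordK (quadPiece (a + b)) s + fordK (quadPiece (a + 2 * b)) s) +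
      (fordLaplace₀ (quadPiece a) (s - 1) - 2 * fordLaplace₀ (quadPiece (a + b)) (s - 1) +
        fordLaplace₀ (quadPiece (a + 2 * b)) (s - 1)) -
      (∑' ρ : RHWave0.riemannZetaNontrivialZeros, (riemannZetaZeroOrder (ρ : ℂ) : ℂ) *
        (fordLaplace₀ (quadPiece a) (s - ρ) - 2 * fordLaplace₀ (quadPiece (a + b)) (s - ρ) +
          fordLaplace₀ (quadPiece (a + 2 * b)) (s - ρ))) +
      (smoothedEFRemainder (quadPiece a) s - 2 * smoothedEFRemainder (quadPiece (a + b)) s +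
        smoothedEFRemainder (quadPiece (a + 2 * b)) s) := by
  have hT1 := isSmoothedEFTest_quadPiece ha
  have hT2 := isSmoothedEFTest_quadPiece (a := a + b) (by linarith)
  have hT3 := isSmoothedEFTest_quadPiece (a := a + 2 * b) (by linarith)
  have h1 := SmoothedEF.fordK_eq_explicit hT1 hσ₁ hσ₂ hs1 hζs
  have h2 := SmoothedEF.fordK_eq_explicit hT2 hσ₁ hσ₂ hs1 hζs
  have h3 := SmoothedEF.fordK_eq_explicit hT3 hσ₁ hσ₂ hs1 hζs
  have hs1' := (SmoothedEF.summable_norm_zeroTerm hT1 hσ₁ hζs).of_norm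
  have hs2' := (SmoothedEF.summable_norm_zeroTerm hT2 hσ₁ hζs).of_norm
  have hs3' := (SmoothedEF.summable_norm_zeroTerm hT3 hσ₁ hζs).of_norm
  set S1 := ∑' ρ : RHWave0.riemannZetaNontrivialZeros,
    (riemannZetaZeroOrder (ρ : ℂ) : ℂ) * fordLaplace₀ (quadPiece a) (s - ρ) with hS1
  set S2 := ∑' ρ : RHWave0.riemannZetaNontrivialZeros,
    (riemannZetaZeroOrder (ρ : ℂ) : ℂ) * fordLaplace₀ (quadPiece (a + b)) (s - ρ) with hS2
  set S3 := ∑' ρ : RHWave0.riemannZetaNontrivialZeros,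
    (riemannZetaZeroOrder (ρ : ℂ) : ℂ) * fordLaplace₀ (quadPiece (a + 2 * b)) (s - ρ) with hS3
  have hS : ∑' ρ : RHWave0.riemannZetaNontrivialZeros, (riemannZetaZeroOrder (ρ : ℂ) : ℂ) *
        (fordLaplace₀ (quadPiece a) (s - ρ) - 2 * fordLaplace₀ (quadPiece (a + b)) (s - ρ) +
          fordLaplace₀ (quadPiece (a + 2 * b)) (s - ρ)) = S1 - 2 * S2 + S3 := by
    have e : ∀ ρ : RHWave0.riemannZetaNontrivialZeros, (riemannZetaZeroOrder (ρ : ℂ) : ℂ) *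
        (fordLaplace₀ (quadPiece a) (s - ρ) - 2 * fordLaplace₀ (quadPiece (a + b)) (s - ρ) +
          fordLaplace₀ (quadPiece (a + 2 * b)) (s - ρ)) =
        (riemannZetaZeroOrder (ρ : ℂ) : ℂ) * fordLaplace₀ (quadPiece a) (s - ρ) -
          2 * ((riemannZetaZeroOrder (ρ : ℂ) : ℂ) * fordLaplace₀ (quadPiece (a + b)) (s - ρ)) +
          (riemannZetaZeroOrder (ρ : ℂ) : ℂ) * fordLaplace₀ (quadPiece (a + 2 * b)) (s - ρ) :=
      fun ρ ↦ by ring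
    simp_rw [e]
    rw [(hs1'.sub (hs2'.mul_left 2)).tsum_add hs3', hs1'.tsum_sub (hs2'.mul_left 2), tsum_mul_left]
  rw [hS]
  have hg : ((quadPiece a 0 : ℝ) : ℂ) - 2 * ((quadPiece (a + b) 0 : ℝ) : ℂ) +
      ((quadPiece (a + 2 * b) 0 : ℝ) : ℂ) = 2 * (b : ℂ) ^ 2 := by
    rw [quadPiece_zero _ ha, quadPiece_zero _ (by linarith), quadPiece_zero _ (by linarith)]
    push_cast; ring
  linear_combination h1 - 2 * h2 + h3 - (deriv riemannZeta s / riemannZeta s) * hg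

/-! ## F. The sum over the zeros under RH -/

/-- **The sum over the zeros under RH**: for `Re s = σ > 1/2` every non-trivial zero has
`Re(s − ρ) = σ − 1/2 =: d`, so `‖Σ_ρ m(ρ) kernel(s − ρ)‖ ≤ (8e^{−ad}/d²) Σ_ρ m(ρ) Re 1/(s − ρ) = (8e^{−ad}/d²) Re ξ′/ξ(s)`
(`hasSum_zeroOrder_mul_re_inv_sub`) — the printed "`Σ_ρ 1/|s−ρ|² = (Re ζ′/ζ(s) + ½ log τ + O(1))/(σ − ½)`",
(10.29)–(10.30). [cite: MontgomeryVaughan2007, Thm 13.13 (proof)] -/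
theorem norm_zeroSum_le (hRH : RiemannHypothesis) {a b : ℝ} (ha : 0 ≤ a) (hb : 0 ≤ b) {s : ℂ}
    (hs : 1 / 2 < s.re) :
    ‖∑' ρ : RHWave0.riemannZetaNontrivialZeros, (riemannZetaZeroOrder (ρ : ℂ) : ℂ) *
        (fordLaplace₀ (quadPiece a) (s - ρ) - 2 * fordLaplace₀ (quadPiece (a + b)) (s - ρ) +
          fordLaplace₀ (quadPiece (a + 2 * b)) (s - ρ))‖ ≤
      8 * Real.exp (-(a * (s.re - 1 / 2))) / (s.re - 1 / 2) ^ 2 * (logDeriv riemannXi s).re := by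
  have hd0 : 0 < s.re - 1 / 2 := by linarith
  have hζs : riemannZeta s ≠ 0 :=
    riemannZeta_ne_zero_of_riemannHypothesis hRH (by linarith) (ne_of_gt hs)
  have hσ₁ : -(1 / 2) < s.re := by linarith
  have hT1 := isSmoothedEFTest_quadPiece ha
  have hT2 := isSmoothedEFTest_quadPiece (a := a + b) (by linarith)
  have hT3 := isSmoothedEFTest_quadPiece (a := a + 2 * b) (by linarith)
  have hn1 := SmoothedEF.summable_norm_zeroTerm hT1 hσ₁ hζs
  have hn2 := SmoothedEF.summable_norm_zeroTerm hT2 hσ₁ hζs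
  have hn3 := SmoothedEF.summable_norm_zeroTerm hT3 hσ₁ hζs
  set κ : ℝ := 8 * Real.exp (-(a * (s.re - 1 / 2))) / (s.re - 1 / 2) ^ 2 with hκ
  have hκ0 : 0 ≤ κ := by positivity
  have hH := hasSum_zeroOrder_mul_re_inv_sub hζs
  -- the pointwise bound at each zero
  have hpt : ∀ ρ : RHWave0.riemannZetaNontrivialZeros,
      ‖(riemannZetaZeroOrder (ρ : ℂ) : ℂ) *
          (fordLaplace₀ (quadPiece a) (s - ρ) - 2 * fordLaplace₀ (quadPiece (a + b)) (s - ρ) +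
            fordLaplace₀ (quadPiece (a + 2 * b)) (s - ρ))‖ ≤
        κ * ((riemannZetaZeroOrder (ρ : ℂ) : ℝ) * (1 / (s - ρ)).re) := by
    intro ρ
    have hρ0 : riemannZeta ρ = 0 := ZetaZeros.riemannZetaNontrivialZeros.zeta_eq_zero ρ.2
    have hρre : (ρ : ℂ).re = 1 / 2 :=
      re_eq_one_half_of_riemannHypothesis hRH hρ0 (ZetaZeros.riemannZetaNontrivialZeros.re_pos ρ.2)
    have hzre : (s - ρ).re = s.re - 1 / 2 := by rw [sub_re, hρre]
    have hz0 : s - (ρ : ℂ) ≠ 0 := fun h ↦ by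
      have := congrArg Complex.re h
      rw [hzre, Complex.zero_re] at this
      linarith
    have hm : (0 : ℝ) ≤ riemannZetaZeroOrder (ρ : ℂ) := ZetaZeroSum.zeroOrder_nonneg ρ
    have hk := norm_kernel_le_zero (a := a) hb (z := s - ρ) (by rw [hzre]; exact hd0)
    rw [← comb_fordLaplace₀_eq ha hb hz0, hzre] at hk
    rw [norm_mul, Complex.norm_intCast, abs_of_nonneg hm]
    calc (riemannZetaZeroOrder (ρ : ℂ) : ℝ) *
          ‖fordLaplace₀ (quadPiece a) (s - ρ) - 2 * fordLaplace₀ (quadPiece (a + b)) (s - ρ) +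
            fordLaplace₀ (quadPiece (a + 2 * b)) (s - ρ)‖
        ≤ (riemannZetaZeroOrder (ρ : ℂ) : ℝ) * (κ * (1 / (s - ρ)).re) := mul_le_mul_of_nonneg_left hk hm
      _ = κ * ((riemannZetaZeroOrder (ρ : ℂ) : ℝ) * (1 / (s - ρ)).re) := by ring
  -- summability of the norms of the combination
  have hsumm : Summable fun ρ : RHWave0.riemannZetaNontrivialZeros ↦
      ‖(riemannZetaZeroOrder (ρ : ℂ) : ℂ) *
          (fordLaplace₀ (quadPiece a) (s - ρ) - 2 * fordLaplace₀ (quadPiece (a + b)) (s - ρ) +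
            fordLaplace₀ (quadPiece (a + 2 * b)) (s - ρ))‖ := by
    refine Summable.of_nonneg_of_le (fun _ ↦ norm_nonneg _) (fun ρ ↦ ?_)
      ((hn1.add (hn2.mul_left 2)).add hn3)
    have e : (riemannZetaZeroOrder (ρ : ℂ) : ℂ) *
        (fordLaplace₀ (quadPiece a) (s - ρ) - 2 * fordLaplace₀ (quadPiece (a + b)) (s - ρ) +
          fordLaplace₀ (quadPiece (a + 2 * b)) (s - ρ)) =
        ((riemannZetaZeroOrder (ρ : ℂ) : ℂ) * fordLaplace₀ (quadPiece a) (s - ρ) -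
          2 * ((riemannZetaZeroOrder (ρ : ℂ) : ℂ) * fordLaplace₀ (quadPiece (a + b)) (s - ρ))) +
          (riemannZetaZeroOrder (ρ : ℂ) : ℂ) * fordLaplace₀ (quadPiece (a + 2 * b)) (s - ρ) := by ring
    rw [e]
    calc ‖((riemannZetaZeroOrder (ρ : ℂ) : ℂ) * fordLaplace₀ (quadPiece a) (s - ρ) -
          2 * ((riemannZetaZeroOrder (ρ : ℂ) : ℂ) * fordLaplace₀ (quadPiece (a + b)) (s - ρ))) +
          (riemannZetaZeroOrder (ρ : ℂ) : ℂ) * fordLaplace₀ (quadPiece (a + 2 * b)) (s - ρ)‖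
        ≤ ‖(riemannZetaZeroOrder (ρ : ℂ) : ℂ) * fordLaplace₀ (quadPiece a) (s - ρ) -
          2 * ((riemannZetaZeroOrder (ρ : ℂ) : ℂ) * fordLaplace₀ (quadPiece (a + b)) (s - ρ))‖ +
          ‖(riemannZetaZeroOrder (ρ : ℂ) : ℂ) * fordLaplace₀ (quadPiece (a + 2 * b)) (s - ρ)‖ :=
          norm_add_le _ _
      _ ≤ ‖(riemannZetaZeroOrder (ρ : ℂ) : ℂ) * fordLaplace₀ (quadPiece a) (s - ρ)‖ +
          ‖2 * ((riemannZetaZeroOrder (ρ : ℂ) : ℂ) * fordLaplace₀ (quadPiece (a + b)) (s - ρ))‖ +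
          ‖(riemannZetaZeroOrder (ρ : ℂ) : ℂ) * fordLaplace₀ (quadPiece (a + 2 * b)) (s - ρ)‖ := by
          gcongr; exact norm_sub_le _ _
      _ = _ := by rw [norm_mul (2 : ℂ), Complex.norm_ofNat]
  calc ‖∑' ρ : RHWave0.riemannZetaNontrivialZeros, (riemannZetaZeroOrder (ρ : ℂ) : ℂ) *
        (fordLaplace₀ (quadPiece a) (s - ρ) - 2 * fordLaplace₀ (quadPiece (a + b)) (s - ρ) +
          fordLaplace₀ (quadPiece (a + 2 * b)) (s - ρ))‖
      ≤ ∑' ρ : RHWave0.riemannZetaNontrivialZeros, ‖(riemannZetaZeroOrder (ρ : ℂ) : ℂ) *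
        (fordLaplace₀ (quadPiece a) (s - ρ) - 2 * fordLaplace₀ (quadPiece (a + b)) (s - ρ) +
          fordLaplace₀ (quadPiece (a + 2 * b)) (s - ρ))‖ := norm_tsum_le_tsum_norm hsumm
    _ ≤ ∑' ρ : RHWave0.riemannZetaNontrivialZeros,
        κ * ((riemannZetaZeroOrder (ρ : ℂ) : ℝ) * (1 / (s - (ρ : ℂ))).re) :=
        hsumm.tsum_le_tsum hpt (hH.summable.mul_left κ)
    _ = κ * (logDeriv riemannXi s).re := by rw [tsum_mul_left, hH.tsum_eq]

/-! ## G. Titchmarsh (14.5.1) -/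

/-- `Re ξ′/ξ(σ + it) ≤ ‖ζ′/ζ(σ + it)‖ + ½ log t + 2` for `0 < σ < 1`, `t ≥ 3`, `ζ(σ+it) ≠ 0` (from
`abs_re_logDeriv_xi_sub_le`: the printed `Σ 1/|s−ρ|²·(σ−½) = Re ζ′/ζ + ½ log τ + O(1)`).
[cite: MontgomeryVaughan2007, Thm 13.13 (proof, via Theorem C.1)] -/
private theorem re_logDeriv_xi_le {σ t : ℝ} (hσ0 : 0 < σ) (hσ1 : σ < 1) (ht : 3 ≤ t)
    (hζ : riemannZeta (σ + t * I) ≠ 0) :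
    (logDeriv riemannXi (σ + t * I)).re ≤
      ‖deriv riemannZeta (σ + t * I) / riemannZeta (σ + t * I)‖ + 1 / 2 * Real.log t + 2 := by
  set s : ℂ := σ + t * I with hs
  have hsre : s.re = σ := by simp [hs]
  have hsim : s.im = t := by simp [hs]
  have ht0 : 0 < t := by linarith
  have hE := Lagarias2005Spacing.abs_re_logDeriv_xi_sub_le (s := s) (by rw [hsre]; exact hσ0)
    (by rw [hsim, abs_of_pos ht0]; linarith) hζ
  rw [hsre, hsim, abs_of_pos ht0] at hE
  have h1 := (abs_le.1 hE).2
  have hlog : Real.log (t / (2 * π)) ≤ Real.log t := by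
    refine Real.log_le_log (by positivity) ?_
    rw [div_le_iff₀ (by positivity)]
    nlinarith [Real.pi_gt_three]
  have hZ := Complex.re_le_norm (deriv riemannZeta s / riemannZeta s)
  have habs : |σ - 1| = 1 - σ := by rw [abs_of_neg (by linarith)]; ring
  rw [habs] at h1
  have hfrac : (2 * σ + (1 - σ) + 2) / t ≤ 2 := by
    rw [div_le_iff₀ ht0]; nlinarith
  linarith

set_option maxHeartbeats 400000 in
/-- **Titchmarsh, Theorem 14.5, (14.5.1)** (Littlewood 1924; Montgomery–Vaughan Thm 13.13 / Cor 13.14):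
under RH, for fixed `½ < σ < 1` there is `C` with `‖ζ′/ζ(σ + it)‖ ≤ C (log t)^{2−2σ}` for all `t ≥ 3`.
Printed "uniformly for `½ < σ₀ ≤ σ ≤ σ₁ < 1`"; typed for each fixed `σ` (the constant depends on `σ`).
The proof is Montgomery–Vaughan's (two-scale explicit formula, `y = e^{1/(σ−½)}`, `x = 8^{1/(σ−½)}(log t)²`),
not Titchmarsh's §14.4–14.5 road — same statement.
[cite: Titchmarsh1986, Thm 14.5 (14.5.1)] [cite: MontgomeryVaughan2007, Thm 13.13, Cor 13.14] -/
theorem norm_logDeriv_zeta_le_log_rpow (hRH : RiemannHypothesis) {σ : ℝ} (hσ : 1 / 2 < σ)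
    (hσ1 : σ < 1) :
    ∃ C : ℝ, ∀ t : ℝ, 3 ≤ t →
      ‖deriv riemannZeta (σ + t * I) / riemannZeta (σ + t * I)‖ ≤ C * Real.log t ^ (2 - 2 * σ) := by
  obtain ⟨CJ, hCJ0, hCJ⟩ := norm_comb_remainder_le
  obtain ⟨d, hd⟩ : ∃ d : ℝ, d = σ - 1 / 2 := ⟨_, rfl⟩
  have hd0 : 0 < d := by rw [hd]; linarith
  obtain ⟨b, hb⟩ : ∃ b : ℝ, b = 1 / d := ⟨_, rfl⟩
  have hb0 : 0 < b := by rw [hb]; positivity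
  have hbd : b * d = 1 := by rw [hb]; field_simp
  have h1σ : 0 < 1 - σ := by linarith
  have hlog8 : 0 < Real.log 8 := Real.log_pos (by norm_num)
  obtain ⟨M₈, hM₈⟩ : ∃ M : ℝ, M = Real.exp (Real.log 8 / d) := ⟨_, rfl⟩
  have hM₈0 : 0 < M₈ := by rw [hM₈]; exact Real.exp_pos _
  obtain ⟨M, hM⟩ : ∃ M : ℝ, M = M₈ * Real.exp (2 * b) := ⟨_, rfl⟩
  have hM0 : 0 < M := by rw [hM]; positivity
  -- the constants of the four pieces
  set CK : ℝ := 2 * b ^ 2 * ((Real.log 4 + 4) * (2 * M) ^ (1 - σ) / (1 - σ)) with hCK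
  set CF : ℝ := 2 * M₈ ^ (1 - σ) * (1 + Real.exp (b * (1 - σ))) ^ 2 / 27 with hCF
  set CJ' : ℝ := 3 * CJ / M₈ with hCJ'
  have hCK0 : 0 ≤ CK := by positivity
  have hCF0 : 0 ≤ CF := by positivity
  have hCJ'0 : 0 ≤ CJ' := by positivity
  refine ⟨(CK + CF + CJ' + 3 * b ^ 2) / b ^ 2, fun t ht ↦ ?_⟩
  have ht0 : 0 < t := by linarith
  have hexp1 : Real.exp 1 < 3 := lt_trans Real.exp_one_lt_d9 (by norm_num)
  have hL1 : 1 ≤ Real.log t := by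
    rw [Real.le_log_iff_exp_le ht0]; linarith
  have hL0 : 0 < Real.log t := by linarith
  have hLL0 : 0 ≤ Real.log (Real.log t) := Real.log_nonneg hL1
  set e : ℝ := 2 - 2 * σ with he
  have he0 : 0 ≤ e := by rw [he]; linarith
  have hLe1 : 1 ≤ Real.log t ^ e := Real.one_le_rpow hL1 he0
  have hL2e : (Real.log t ^ 2) ^ (1 - σ) = Real.log t ^ e := by
    rw [← Real.rpow_natCast (Real.log t) 2, ← Real.rpow_mul hL0.le]
    congr 1; rw [he]; push_cast; ring
  -- the two-scale parameters: `a = log x`, `x = 8^{1/d} (log t)²`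
  obtain ⟨a, ha⟩ : ∃ a : ℝ, a = Real.log 8 / d + 2 * Real.log (Real.log t) := ⟨_, rfl⟩
  have ha0 : 0 ≤ a := by rw [ha]; positivity
  have hexp2 : Real.exp (2 * Real.log (Real.log t)) = Real.log t ^ 2 := by
    rw [show 2 * Real.log (Real.log t) = Real.log (Real.log t) + Real.log (Real.log t) by ring,
      Real.exp_add, Real.exp_log hL0]; ring
  have hea : Real.exp a = M₈ * Real.log t ^ 2 := by
    rw [ha, Real.exp_add, hM₈, hexp2]
  have head : 8 * Real.exp (-(a * d)) = Real.log t ^ (-(2 * d)) := by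
    have e1 : -(a * d) = -Real.log 8 + Real.log (Real.log t) * (-(2 * d)) := by
      rw [ha]; field_simp; ring
    rw [e1, Real.exp_add, Real.exp_neg, Real.exp_log (by norm_num : (0 : ℝ) < 8),
      ← Real.rpow_def_of_pos hL0]
    ring
  have hea2b : Real.exp (a + 2 * b) = M * Real.log t ^ 2 := by
    rw [Real.exp_add, hea, hM]; ring
  -- the point `s = σ + it`
  set s : ℂ := σ + t * I with hs
  have hsre : s.re = σ := by simp [hs]
  have hsim : s.im = t := by simp [hs]
  have hζs : riemannZeta s ≠ 0 :=
    riemannZeta_ne_zero_of_riemannHypothesis hRH (by rw [hsre]; linarith) (by rw [hsre]; exact ne_of_gt hσ)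
  have hs1 : s ≠ 1 := fun h ↦ by
    have := congrArg Complex.im h
    rw [hsim, Complex.one_im] at this
    linarith
  have heq := explicit_formula_twoScale ha0 hb0.le (s := s) (by rw [hsre]; linarith)
    (by rw [hsre]; linarith) hs1 hζs
  set Z := deriv riemannZeta s / riemannZeta s with hZ
  set Kc := fordK (quadPiece a) s - 2 * fordK (quadPiece (a + b)) s + fordK (quadPiece (a + 2 * b)) s
    with hKc
  set Fc := fordLaplace₀ (quadPiece a) (s - 1) - 2 * fordLaplace₀ (quadPiece (a + b)) (s - 1) +
    fordLaplace₀ (quadPiece (a + 2 * b)) (s - 1) with hFc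
  set Sc := ∑' ρ : RHWave0.riemannZetaNontrivialZeros, (riemannZetaZeroOrder (ρ : ℂ) : ℂ) *
    (fordLaplace₀ (quadPiece a) (s - ρ) - 2 * fordLaplace₀ (quadPiece (a + b)) (s - ρ) +
      fordLaplace₀ (quadPiece (a + 2 * b)) (s - ρ)) with hSc
  set Jc := smoothedEFRemainder (quadPiece a) s - 2 * smoothedEFRemainder (quadPiece (a + b)) s +
    smoothedEFRemainder (quadPiece (a + 2 * b)) s with hJc
  -- the triangle inequality
  have htri : 2 * b ^ 2 * ‖Z‖ ≤ ‖Kc‖ + ‖Fc‖ + ‖Sc‖ + ‖Jc‖ := by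
    have e1 : 2 * b ^ 2 * ‖Z‖ = ‖2 * (b : ℂ) ^ 2 * Z‖ := by
      rw [norm_mul, norm_mul, Complex.norm_ofNat, norm_pow, Complex.norm_real, Real.norm_eq_abs,
        abs_of_pos hb0]
    rw [e1, heq]
    calc ‖-Kc + Fc - Sc + Jc‖ ≤ ‖-Kc + Fc - Sc‖ + ‖Jc‖ := norm_add_le _ _
      _ ≤ ‖-Kc + Fc‖ + ‖Sc‖ + ‖Jc‖ := by gcongr; exact norm_sub_le _ _
      _ ≤ ‖-Kc‖ + ‖Fc‖ + ‖Sc‖ + ‖Jc‖ := by gcongr; exact norm_add_le _ _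
      _ = ‖Kc‖ + ‖Fc‖ + ‖Sc‖ + ‖Jc‖ := by rw [norm_neg]
  -- (1) the Dirichlet polynomial
  have hK : ‖Kc‖ ≤ CK * Real.log t ^ e := by
    set N : ℕ := ⌊Real.exp (a + 2 * b)⌋₊ + 1 with hN
    have hN1 : 1 ≤ N := by rw [hN]; omega
    have hNpos : (0 : ℝ) < N := by exact_mod_cast hN1
    have hNle : (N : ℝ) ≤ 2 * (M * Real.log t ^ 2) := by
      rw [← hea2b, hN]
      push_cast
      have h1 := Nat.floor_le (Real.exp_pos (a + 2 * b)).le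
      have h2 : 1 ≤ Real.exp (a + 2 * b) := Real.one_le_exp (by positivity)
      linarith
    have hNge : Real.exp (a + 2 * b) ≤ N := by
      rw [hN]; push_cast; exact (Nat.lt_floor_add_one _).le
    have hlogN : a + 2 * b ≤ Real.log N := by
      rw [Real.le_log_iff_exp_le hNpos]; exact hNge
    have h1 := norm_comb_fordK_le (a := a) hb0 s hN1 hlogN
    rw [hsre] at h1
    have h2 := sum_range_vonMangoldt_mul_rpow_le (by linarith : 0 < σ) hσ1 N
    have h3 : (N : ℝ) ^ (1 - σ) ≤ (2 * M) ^ (1 - σ) * Real.log t ^ e := by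
      calc (N : ℝ) ^ (1 - σ) ≤ (2 * (M * Real.log t ^ 2)) ^ (1 - σ) :=
            Real.rpow_le_rpow hNpos.le hNle h1σ.le
        _ = (2 * M) ^ (1 - σ) * (Real.log t ^ 2) ^ (1 - σ) := by
            rw [show 2 * (M * Real.log t ^ 2) = (2 * M) * Real.log t ^ 2 by ring,
              Real.mul_rpow (by positivity) (by positivity)]
        _ = (2 * M) ^ (1 - σ) * Real.log t ^ e := by rw [hL2e]
    have hc4 : 0 < Real.log 4 + 4 := by have := Real.log_pos (by norm_num : (1 : ℝ) < 4); linarith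
    calc ‖Kc‖ ≤ 2 * b ^ 2 * ∑ n ∈ Finset.range N,
          (ArithmeticFunction.vonMangoldt n : ℝ) * (n : ℝ) ^ (-σ) := h1
      _ ≤ 2 * b ^ 2 * ((Real.log 4 + 4) * (N : ℝ) ^ (1 - σ) / (1 - σ)) :=
          mul_le_mul_of_nonneg_left h2 (by positivity)
      _ ≤ 2 * b ^ 2 * ((Real.log 4 + 4) * ((2 * M) ^ (1 - σ) * Real.log t ^ e) / (1 - σ)) := by
          gcongr
      _ = CK * Real.log t ^ e := by rw [hCK]; ring
  -- (2) the term of the pole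
  have hF : ‖Fc‖ ≤ CF * Real.log t ^ e := by
    have hz1im : (s - 1).im = t := by rw [sub_im, hsim, Complex.one_im, sub_zero]
    have hz1re : (s - 1).re = σ - 1 := by rw [sub_re, hsre, Complex.one_re]
    have hz1 : s - 1 ≠ 0 := fun h ↦ by
      have := congrArg Complex.im h
      rw [hz1im, Complex.zero_im] at this
      linarith
    have hn1 : t ≤ ‖s - 1‖ := by
      have := Complex.abs_im_le_norm (s - 1)
      rwa [hz1im, abs_of_pos ht0] at this
    have hn3 : (27 : ℝ) ≤ ‖s - 1‖ ^ 3 := by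
      have h3 : (3 : ℝ) ≤ ‖s - 1‖ := ht.trans hn1
      calc (27 : ℝ) = 3 ^ 3 := by norm_num
        _ ≤ ‖s - 1‖ ^ 3 := pow_le_pow_left₀ (by norm_num) h3 3
    rw [hFc, comb_fordLaplace₀_eq ha0 hb0.le hz1]
    refine (norm_kernel_le hz1).trans ?_
    rw [hz1re]
    have hea' : Real.exp (-(a * (σ - 1))) = M₈ ^ (1 - σ) * Real.log t ^ e := by
      rw [show -(a * (σ - 1)) = a * (1 - σ) by ring, Real.exp_mul, hea,
        Real.mul_rpow hM₈0.le (by positivity), hL2e]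
    have heb' : Real.exp (-(b * (σ - 1))) = Real.exp (b * (1 - σ)) := by congr 1; ring
    rw [hea', heb']
    have hnum0 : 0 ≤ 2 * (M₈ ^ (1 - σ) * Real.log t ^ e) * (1 + Real.exp (b * (1 - σ))) ^ 2 := by
      positivity
    calc 2 * (M₈ ^ (1 - σ) * Real.log t ^ e) * (1 + Real.exp (b * (1 - σ))) ^ 2 / ‖s - 1‖ ^ 3
        ≤ 2 * (M₈ ^ (1 - σ) * Real.log t ^ e) * (1 + Real.exp (b * (1 - σ))) ^ 2 / 27 :=
          div_le_div_of_nonneg_left hnum0 (by norm_num) hn3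
      _ = CF * Real.log t ^ e := by rw [hCF]; ring
  -- (3) the left-line remainder
  have hJ : ‖Jc‖ ≤ CJ' * Real.log t ^ e := by
    have h1 := hCJ a b ha0 hb0.le s (by rw [hsre]; linarith)
    rw [hsim, hsre, abs_of_pos ht0] at h1
    have hlog2 : Real.log 2 < 1 := lt_trans Real.log_two_lt_d9 (by norm_num)
    have hl : 1 + Real.log (1 + t) ≤ 3 * Real.log t := by
      have : Real.log (1 + t) ≤ Real.log (2 * t) := Real.log_le_log (by linarith) (by linarith)
      rw [Real.log_mul (by norm_num) ht0.ne'] at this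
      linarith
    have hex : Real.exp (-(a * (σ + 1 / 2))) ≤ (M₈ * Real.log t ^ 2)⁻¹ := by
      rw [← hea, ← Real.exp_neg, Real.exp_le_exp]
      nlinarith
    have hM₈L : 0 < M₈ * Real.log t ^ 2 := by positivity
    have hLne : Real.log t ≠ 0 := hL0.ne'
    calc ‖Jc‖ ≤ CJ * (1 + Real.log (1 + t)) * Real.exp (-(a * (σ + 1 / 2))) := h1
      _ ≤ CJ * (3 * Real.log t) * (M₈ * Real.log t ^ 2)⁻¹ :=
          mul_le_mul (mul_le_mul_of_nonneg_left hl hCJ0.le) hex (Real.exp_pos _).le (by positivity)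
      _ = CJ' * (1 / Real.log t) * (Real.log t * (Real.log t)⁻¹) := by
          rw [hCJ', mul_inv, pow_two, mul_inv]; ring
      _ = CJ' * (1 / Real.log t) := by rw [mul_inv_cancel₀ hLne, mul_one]
      _ ≤ CJ' * Real.log t ^ e := by
          refine mul_le_mul_of_nonneg_left ?_ hCJ'0
          calc 1 / Real.log t ≤ 1 := by rw [div_le_one hL0]; exact hL1
            _ ≤ Real.log t ^ e := hLe1
  -- (4) the zeros: `‖Sc‖ ≤ b²(log t)^{−2d}·Re ξ′/ξ(s) ≤ b²‖Z‖ + ½ b² (log t)^e + 2b²`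
  have hS : ‖Sc‖ ≤ b ^ 2 * ‖Z‖ + 1 / 2 * b ^ 2 * Real.log t ^ e + 2 * b ^ 2 := by
    have h1 := norm_zeroSum_le hRH ha0 hb0.le (s := s) (by rw [hsre]; exact hσ)
    rw [hsre, ← hd] at h1
    have hκ : 8 * Real.exp (-(a * d)) / d ^ 2 = b ^ 2 * Real.log t ^ (-(2 * d)) := by
      rw [mul_div_assoc, show Real.exp (-(a * d)) / d ^ 2 = Real.exp (-(a * d)) * b ^ 2 by
        rw [hb]; field_simp, ← mul_assoc, head]; ring
    rw [hκ] at h1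
    have hξ := re_logDeriv_xi_le (t := t) (by linarith : 0 < σ) hσ1 ht hζs
    have hW0 : 0 ≤ ‖Z‖ + 1 / 2 * Real.log t + 2 := by positivity
    have hp0 : 0 ≤ Real.log t ^ (-(2 * d)) := Real.rpow_nonneg hL0.le _
    have hp1 : Real.log t ^ (-(2 * d)) ≤ 1 :=
      Real.rpow_le_one_of_one_le_of_nonpos hL1 (by linarith)
    have hpe : Real.log t ^ (-(2 * d)) * Real.log t = Real.log t ^ e := by
      rw [← Real.rpow_add_one hL0.ne']
      congr 1; rw [he, hd]; ring
    calc ‖Sc‖ ≤ b ^ 2 * Real.log t ^ (-(2 * d)) * (logDeriv riemannXi s).re := h1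
      _ ≤ b ^ 2 * Real.log t ^ (-(2 * d)) * (‖Z‖ + 1 / 2 * Real.log t + 2) :=
          mul_le_mul_of_nonneg_left hξ (by positivity)
      _ = b ^ 2 * (Real.log t ^ (-(2 * d)) * ‖Z‖) +
            1 / 2 * b ^ 2 * (Real.log t ^ (-(2 * d)) * Real.log t) +
            2 * b ^ 2 * Real.log t ^ (-(2 * d)) := by ring
      _ ≤ b ^ 2 * (1 * ‖Z‖) + 1 / 2 * b ^ 2 * Real.log t ^ e + 2 * b ^ 2 * 1 := by
          rw [hpe]
          gcongr
      _ = b ^ 2 * ‖Z‖ + 1 / 2 * b ^ 2 * Real.log t ^ e + 2 * b ^ 2 := by ring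
  -- assemble
  have hb2 : 0 < b ^ 2 := by positivity
  have h2b : 2 * b ^ 2 ≤ 2 * b ^ 2 * Real.log t ^ e := le_mul_of_one_le_right (by positivity) hLe1
  have hmain : b ^ 2 * ‖Z‖ ≤ (CK + CF + CJ' + 3 * b ^ 2) * Real.log t ^ e := by
    linarith
  rw [div_mul_eq_mul_div, le_div_iff₀ hb2]
  linarith

end LittlewoodRH

open LittlewoodRH

/-! ## H. Lagarias 2005, Lemma 4.1 (3) and Theorem 4.1 (2) -/

/-- **Lagarias 2005, Lemma 4.1 (3)** — discharge of `lagarias2005_lemma_4_1_3` (RH-CONDITIONAL, the RH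
binder kept as the hypothesis): under RH, for `0 < h < ½`, `R_h(T) = sup_{T ≤ t ≤ T+1} |ζ′/ζ(½ + h + it)|
= O((log T)^{1−2h})` as `T → +∞` ("shown in Titchmarsh", Thm 14.5 (14.5.1), here
`LittlewoodRH.norm_logDeriv_zeta_le_log_rpow` at `σ = ½ + h`; `log(T+1) ≤ 2 log T` for `T ≥ 3`).
[cite: Lagarias2005, Lemma 4.1 (3) p.8] [cite: Titchmarsh1986, Thm 14.5 (14.5.1)] -/
theorem lagarias2005_lemma_4_1_3_holds : lagarias2005_lemma_4_1_3 := by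
  intro hRH h hh0 hh
  obtain ⟨C, hC⟩ := norm_logDeriv_zeta_le_log_rpow hRH (σ := 1 / 2 + h) (by linarith) (by linarith)
  have he : (2 : ℝ) - 2 * (1 / 2 + h) = 1 - 2 * h := by ring
  rw [he] at hC
  have he0 : 0 ≤ 1 - 2 * h := by linarith
  rw [Asymptotics.isBigO_iff]
  refine ⟨|C| * 2 ^ (1 - 2 * h), ?_⟩
  filter_upwards [eventually_ge_atTop (3 : ℝ)] with T hT
  have hT0 : 0 < T := by linarith
  have hlogT : 1 ≤ Real.log T := by
    rw [Real.le_log_iff_exp_le hT0]; linarith [lt_trans Real.exp_one_lt_d9 (by norm_num : (2.7182818286 : ℝ) < 3)]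
  have hlogT0 : 0 < Real.log T := by linarith
  -- pointwise bound on `[T, T+1]`
  have hpt : ∀ t ∈ Icc T (T + 1),
      ‖deriv riemannZeta (1 / 2 + h + t * I) / riemannZeta (1 / 2 + h + t * I)‖ ≤
        |C| * 2 ^ (1 - 2 * h) * Real.log T ^ (1 - 2 * h) := by
    intro t ht
    have ht3 : 3 ≤ t := hT.trans ht.1
    have ht0 : 0 < t := by linarith
    have e : (1 / 2 + h + t * I : ℂ) = ((1 / 2 + h : ℝ) : ℂ) + t * I := by push_cast; ring
    have h1 := hC t ht3
    rw [← e] at h1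
    have hlogt : Real.log t ≤ 2 * Real.log T := by
      have : Real.log t ≤ Real.log (2 * T) := Real.log_le_log ht0 (by linarith [ht.2])
      rw [Real.log_mul (by norm_num) hT0.ne'] at this
      linarith [lt_trans Real.log_two_lt_d9 (by norm_num : (0.6931471808 : ℝ) < 1)]
    have hlogt0 : 0 ≤ Real.log t := Real.log_nonneg (by linarith)
    calc ‖deriv riemannZeta (1 / 2 + h + t * I) / riemannZeta (1 / 2 + h + t * I)‖
        ≤ C * Real.log t ^ (1 - 2 * h) := h1
      _ ≤ |C| * Real.log t ^ (1 - 2 * h) :=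
          mul_le_mul_of_nonneg_right (le_abs_self C) (Real.rpow_nonneg hlogt0 _)
      _ ≤ |C| * (2 * Real.log T) ^ (1 - 2 * h) :=
          mul_le_mul_of_nonneg_left (Real.rpow_le_rpow hlogt0 hlogt he0) (abs_nonneg C)
      _ = |C| * 2 ^ (1 - 2 * h) * Real.log T ^ (1 - 2 * h) := by
          rw [Real.mul_rpow (by norm_num) hlogT0.le]; ring
  -- the supremum
  have hne : ((fun t : ℝ ↦ ‖deriv riemannZeta (1 / 2 + h + t * I) / riemannZeta (1 / 2 + h + t * I)‖) ''
      Icc T (T + 1)).Nonempty := (nonempty_Icc.2 (by linarith)).image _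
  have hsup : zetaLogDerivSup h T ≤ |C| * 2 ^ (1 - 2 * h) * Real.log T ^ (1 - 2 * h) := by
    rw [zetaLogDerivSup]
    refine csSup_le hne ?_
    rintro _ ⟨t, ht, rfl⟩
    exact hpt t ht
  have hsup0 : 0 ≤ zetaLogDerivSup h T := by
    rw [zetaLogDerivSup]
    obtain ⟨y, hy⟩ := hne
    have hbdd : BddAbove ((fun t : ℝ ↦ ‖deriv riemannZeta (1 / 2 + h + t * I) /
        riemannZeta (1 / 2 + h + t * I)‖) '' Icc T (T + 1)) := by
      refine ⟨|C| * 2 ^ (1 - 2 * h) * Real.log T ^ (1 - 2 * h), ?_⟩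
      rintro _ ⟨t, ht, rfl⟩
      exact hpt t ht
    obtain ⟨t, ht', rfl⟩ := hy
    exact (norm_nonneg _).trans (le_csSup hbdd ⟨t, ht', rfl⟩)
  rw [Real.norm_eq_abs, abs_of_nonneg hsup0, Real.norm_eq_abs,
    abs_of_nonneg (Real.rpow_nonneg hlogT0.le _)]
  exact hsup

/-- **Lagarias 2005, Theorem 4.1 (2)** — discharge of `lagarias2005_thm_4_1_2` (RH-CONSEQUENCE; the RH
binder of the statement is its hypothesis, never dropped and never asserted): under RH, for `0 < |h| < ½`,
every `0 ≤ θ < 2π` and `k ≥ 1`, the `k` consecutive normalised zero spacings of `A_{h,θ}` and `B_{h,θ}` have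
the trivial limiting distribution. From `lagarias2005_thm_4_1_2_of_lemma_4_1_3`
(`LagariasDifferencedXiSpacingDistributionProofs.lean`) and `lagarias2005_lemma_4_1_3_holds`.
[cite: Lagarias2005, Theorem 4.1 (2) (arXiv p. 8)] -/
theorem lagarias2005_thm_4_1_2_holds : lagarias2005_thm_4_1_2 :=
  lagarias2005_thm_4_1_2_of_lemma_4_1_3 lagarias2005_lemma_4_1_3_holds

end Literature.NumberTheory.LFunctions
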